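import Mathlib
import Summits.Ventures.PercRepro2.WForm

/-!
# A log-supermodular weight satisfies the W-inequality (blind cell PercRepro2, mine-1 g13)
proofs/MINE1-W-BLOCKS.md §0; MINE1-SIDE.md §7 (the forest theorem) — a direct route.

If a weight `W` on `Finset V` satisfies the FKG lattice condition `W s · W t ≤ W (s ∩ t) · W (s ∪ t)`,
then the W-form inequality `WForm.WIneq Disjoint W` holds. Proof: the two-copy disjoint measure
`μ (s, t) = W s · W t · [Disjoint s t]` is log-supermodular on the product lattice
`Finset V × (Finset V)ᵒᵈ` (the second copy with the REVERSED order: meets become unions there, and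
the lattice condition of `W` is symmetric in `∩`/`∪`; disjointness is a sublattice), the function
`(s, t) ↦ 1_U(s) − 1_U(t) + 1` is monotone and nonnegative on that lattice for every upper set `U`,
so Mathlib's `fkg` gives `(∑ μ f)(∑ μ g) ≤ (∑ μ)(∑ μ f g)`; the swap symmetry `(s, t) ↦ (t, s)` kills
the first moments, which leaves `(∑ μ) · Q(1_U, 1_V) ≥ 0`, and the layer cake
(`WForm.wIneq_of_upperSets`) extends from up-set indicators to all monotone pairs.
Consequence (WStatusLSM.lean): a log-supermodular status law satisfies the cell's W-inequality —
in particular the W-inequality holds on every forest (ForestCluster, mine-c).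
-/

namespace Summit.Ventures.PercRepro2.WForm

section LSM

variable {R : Type*} [CommRing R] [LinearOrder R] [IsStrictOrderedRing R]
variable {V : Type*} [Fintype V] [DecidableEq V]

/-- The two-copy disjoint measure on the product lattice `Finset V × (Finset V)ᵒᵈ`. -/
noncomputable def twoCopy (W : Finset V → R) (a : Finset V × (Finset V)ᵒᵈ) : R :=
  coef (fun s t : Finset V => Disjoint s t) W a.1 (OrderDual.ofDual a.2)

omit [Fintype V] [LinearOrder R] [IsStrictOrderedRing R] in
/-- Disjointness is a sublattice condition on `Finset V × (Finset V)ᵒᵈ`. -/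
lemma disjoint_inf_sup {s s' t t' : Finset V} (h : Disjoint s t) (h' : Disjoint s' t') :
    Disjoint (s ∩ s') (t ∪ t') ∧ Disjoint (s ∪ s') (t ∩ t') := by
  constructor
  · rw [Finset.disjoint_union_right]
    exact ⟨Finset.disjoint_of_subset_left Finset.inter_subset_left h,
      Finset.disjoint_of_subset_left Finset.inter_subset_right h'⟩
  · rw [Finset.disjoint_union_left]
    exact ⟨Finset.disjoint_of_subset_right Finset.inter_subset_left h,
      Finset.disjoint_of_subset_right Finset.inter_subset_right h'⟩

omit [Fintype V] in
/-- The two-copy measure of a log-supermodular weight is log-supermodular on the product lattice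
with the second copy reversed. -/
lemma twoCopy_logSupermod {W : Finset V → R} (hW0 : ∀ s, 0 ≤ W s)
    (hW : ∀ s t : Finset V, W s * W t ≤ W (s ∩ t) * W (s ∪ t))
    (a b : Finset V × (Finset V)ᵒᵈ) :
    twoCopy W a * twoCopy W b ≤ twoCopy W (a ⊓ b) * twoCopy W (a ⊔ b) := by
  obtain ⟨s, t⟩ := a
  obtain ⟨s', t'⟩ := b
  have e1 : OrderDual.ofDual (t ⊓ t') = OrderDual.ofDual t ∪ OrderDual.ofDual t' := rfl
  have e2 : OrderDual.ofDual (t ⊔ t') = OrderDual.ofDual t ∩ OrderDual.ofDual t' := rfl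
  simp only [twoCopy, coef, Prod.inf_def, Prod.sup_def, Finset.inf_eq_inter, Finset.sup_eq_union,
    e1, e2]
  by_cases h : Disjoint s (OrderDual.ofDual t)
  · by_cases h' : Disjoint s' (OrderDual.ofDual t')
    · obtain ⟨h1, h2⟩ := disjoint_inf_sup h h'
      rw [if_pos h, if_pos h', if_pos h1, if_pos h2]
      calc W s * W (OrderDual.ofDual t) * (W s' * W (OrderDual.ofDual t'))
          = (W s * W s') * (W (OrderDual.ofDual t) * W (OrderDual.ofDual t')) := by ring
        _ ≤ (W (s ∩ s') * W (s ∪ s')) *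
              (W (OrderDual.ofDual t ∩ OrderDual.ofDual t') *
                W (OrderDual.ofDual t ∪ OrderDual.ofDual t')) :=
            mul_le_mul (hW s s') (hW _ _) (mul_nonneg (hW0 _) (hW0 _))
              (mul_nonneg (hW0 _) (hW0 _))
        _ = W (s ∩ s') * W (OrderDual.ofDual t ∪ OrderDual.ofDual t') *
              (W (s ∪ s') * W (OrderDual.ofDual t ∩ OrderDual.ofDual t')) := by ring
    · rw [if_neg h', mul_zero]
      exact mul_nonneg (by split_ifs <;> first | exact mul_nonneg (hW0 _) (hW0 _) | exact le_rfl)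
        (by split_ifs <;> first | exact mul_nonneg (hW0 _) (hW0 _) | exact le_rfl)
  · rw [if_neg h, zero_mul]
    exact mul_nonneg (by split_ifs <;> first | exact mul_nonneg (hW0 _) (hW0 _) | exact le_rfl)
      (by split_ifs <;> first | exact mul_nonneg (hW0 _) (hW0 _) | exact le_rfl)

/-- The shifted two-copy difference of an upper-set indicator, `1_U(s) − 1_U(t) + 1`. -/
def shiftDiff (U : Finset (Finset V)) (a : Finset V × (Finset V)ᵒᵈ) : R :=
  ind U a.1 - ind U (OrderDual.ofDual a.2) + 1

omit [Fintype V] [LinearOrder R] [IsStrictOrderedRing R] in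
/-- The indicator takes values `0` and `1`. -/
lemma ind_mem (U : Finset (Finset V)) (s : Finset V) : (ind U s : R) = 0 ∨ (ind U s : R) = 1 := by
  unfold ind; split_ifs <;> simp

omit [Fintype V] in
/-- `shiftDiff` is nonnegative. -/
lemma shiftDiff_nonneg (U : Finset (Finset V)) (a : Finset V × (Finset V)ᵒᵈ) :
    0 ≤ (shiftDiff U a : R) := by
  unfold shiftDiff
  rcases ind_mem (R := R) U a.1 with h1 | h1 <;> rcases ind_mem (R := R) U (OrderDual.ofDual a.2) with h2 | h2 <;>
    rw [h1, h2] <;> norm_num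

omit [Fintype V] in
/-- `shiftDiff` of an upper set is monotone on `Finset V × (Finset V)ᵒᵈ`. -/
lemma shiftDiff_monotone {U : Finset (Finset V)} (hU : IsUpperSet (↑U : Set (Finset V))) :
    Monotone (shiftDiff U : Finset V × (Finset V)ᵒᵈ → R) := by
  intro a b hab
  unfold shiftDiff
  have h1 : (ind U a.1 : R) ≤ ind U b.1 := monotone_indicator_of_isUpperSet hU hab.1
  have h2 : (ind U (OrderDual.ofDual b.2) : R) ≤ ind U (OrderDual.ofDual a.2) :=
    monotone_indicator_of_isUpperSet hU (OrderDual.ofDual_le_ofDual.mpr hab.2)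
  linarith

omit [LinearOrder R] [IsStrictOrderedRing R] in
/-- Sums over the product lattice are the double sums of the W-form (re-indexing the dual copy). -/
lemma sum_twoCopy_eq (W : Finset V → R) (X : Finset V → Finset V → R) :
    (∑ a : Finset V × (Finset V)ᵒᵈ, twoCopy W a * X a.1 (OrderDual.ofDual a.2)) =
      ∑ s : Finset V, ∑ t : Finset V, coef (fun s t : Finset V => Disjoint s t) W s t * X s t := by
  rw [Fintype.sum_prod_type]
  refine Finset.sum_congr rfl fun s _ => ?_
  exact Fintype.sum_equiv OrderDual.ofDual _ _ (fun t => rfl)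

omit [LinearOrder R] [IsStrictOrderedRing R] in
/-- The first moments vanish by the swap symmetry `(s, t) ↦ (t, s)`. -/
lemma sum_coef_diff (W : Finset V → R) (g : Finset V → R) :
    (∑ s : Finset V, ∑ t : Finset V, coef (fun s t : Finset V => Disjoint s t) W s t * (g s - g t)) = 0 := by
  have hsym : ∀ s t : Finset V, coef (fun s t : Finset V => Disjoint s t) W s t =
      coef (fun s t : Finset V => Disjoint s t) W t s :=
    coef_symm (fun s t h => h.symm) W
  have e : (∑ s : Finset V, ∑ t : Finset V, coef (fun s t : Finset V => Disjoint s t) W s t * g t) =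
      ∑ s : Finset V, ∑ t : Finset V, coef (fun s t : Finset V => Disjoint s t) W s t * g s := by
    rw [Finset.sum_comm]
    refine Finset.sum_congr rfl fun s _ => Finset.sum_congr rfl fun t _ => ?_
    rw [hsym]
  simp only [mul_sub, Finset.sum_sub_distrib]
  rw [e, sub_self]

/-- **A log-supermodular weight satisfies the W-inequality** (FKG on the product lattice with the
second copy reversed, the swap symmetry, and the layer cake). -/
theorem wIneq_disjoint_of_logSupermod {W : Finset V → R} (hW0 : ∀ s, 0 ≤ W s)
    (hW : ∀ s t : Finset V, W s * W t ≤ W (s ∩ t) * W (s ∪ t)) :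
    WIneq (fun s t : Finset V => Disjoint s t) W := by
  refine wIneq_of_upperSets hW0 ?_
  intro U V' hU hV
  have hμ0 : (0 : Finset V × (Finset V)ᵒᵈ → R) ≤ twoCopy W := fun a =>
    coef_nonneg (fun s t : Finset V => Disjoint s t) hW0 a.1 (OrderDual.ofDual a.2)
  have hf0 : (0 : Finset V × (Finset V)ᵒᵈ → R) ≤ shiftDiff U := fun a => shiftDiff_nonneg U a
  have hg0 : (0 : Finset V × (Finset V)ᵒᵈ → R) ≤ shiftDiff V' := fun a => shiftDiff_nonneg V' a
  have hfkg := fkg (shiftDiff U) (shiftDiff V') (twoCopy W) hμ0 hf0 hg0 (shiftDiff_monotone hU)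
    (shiftDiff_monotone hV) (twoCopy_logSupermod hW0 hW)
  -- rewrite the four sums as double sums
  have eZ : (∑ a : Finset V × (Finset V)ᵒᵈ, twoCopy W a) =
      ∑ s : Finset V, ∑ t : Finset V, coef (fun s t : Finset V => Disjoint s t) W s t := by
    have := sum_twoCopy_eq W (fun _ _ => (1 : R))
    simpa using this
  have ef : (∑ a : Finset V × (Finset V)ᵒᵈ, twoCopy W a * shiftDiff U a) =
      ∑ s : Finset V, ∑ t : Finset V, coef (fun s t : Finset V => Disjoint s t) W s t * ((ind U s - ind U t) + 1) :=
    sum_twoCopy_eq W (fun s t => (ind U s - ind U t) + 1)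
  have eg : (∑ a : Finset V × (Finset V)ᵒᵈ, twoCopy W a * shiftDiff V' a) =
      ∑ s : Finset V, ∑ t : Finset V, coef (fun s t : Finset V => Disjoint s t) W s t * ((ind V' s - ind V' t) + 1) :=
    sum_twoCopy_eq W (fun s t => (ind V' s - ind V' t) + 1)
  have efg : (∑ a : Finset V × (Finset V)ᵒᵈ, twoCopy W a * (shiftDiff U a * shiftDiff V' a)) =
      ∑ s : Finset V, ∑ t : Finset V, coef (fun s t : Finset V => Disjoint s t) W s t *
        (((ind U s - ind U t) + 1) * ((ind V' s - ind V' t) + 1)) :=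
    sum_twoCopy_eq W (fun s t => ((ind U s - ind U t) + 1) * ((ind V' s - ind V' t) + 1))
  rw [ef, eg, eZ, efg] at hfkg
  -- expand: the first moments vanish
  set Z := ∑ s : Finset V, ∑ t : Finset V, coef (fun s t : Finset V => Disjoint s t) W s t with hZ
  set Qf := ∑ s : Finset V, ∑ t : Finset V, coef (fun s t : Finset V => Disjoint s t) W s t * ((ind U s - ind U t) * (ind V' s - ind V' t))
    with hQf
  have hm1 := sum_coef_diff W (fun s => (ind U s : R))
  have hm2 := sum_coef_diff W (fun s => (ind V' s : R))
  have e1 : (∑ s : Finset V, ∑ t : Finset V, coef (fun s t : Finset V => Disjoint s t) W s t * ((ind U s - ind U t) + 1)) = Z := by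
    simp only [mul_add, mul_one, Finset.sum_add_distrib]
    rw [hm1, zero_add]
  have e2 : (∑ s : Finset V, ∑ t : Finset V, coef (fun s t : Finset V => Disjoint s t) W s t * ((ind V' s - ind V' t) + 1)) = Z := by
    simp only [mul_add, mul_one, Finset.sum_add_distrib]
    rw [hm2, zero_add]
  have e3 : (∑ s : Finset V, ∑ t : Finset V, coef (fun s t : Finset V => Disjoint s t) W s t *
      (((ind U s - ind U t) + 1) * ((ind V' s - ind V' t) + 1))) = Qf + Z := by
    have : ∀ s t : Finset V, coef (fun s t : Finset V => Disjoint s t) W s t * (((ind U s - ind U t) + 1) * ((ind V' s - ind V' t) + 1)) =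
        coef (fun s t : Finset V => Disjoint s t) W s t * ((ind U s - ind U t) * (ind V' s - ind V' t)) +
          coef (fun s t : Finset V => Disjoint s t) W s t * (ind U s - ind U t) + coef (fun s t : Finset V => Disjoint s t) W s t * (ind V' s - ind V' t) +
          coef (fun s t : Finset V => Disjoint s t) W s t := fun s t => by ring
    simp only [this, Finset.sum_add_distrib]
    rw [hm1, hm2, add_zero, add_zero]
  rw [e1, e2, e3] at hfkg
  -- hfkg : Z * Z ≤ Z * (Qf + Z)
  have hZ0 : 0 ≤ Z := Finset.sum_nonneg fun s _ => Finset.sum_nonneg fun t _ => coef_nonneg (fun s t : Finset V => Disjoint s t) hW0 s t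
  have hQ : Q (fun s t : Finset V => Disjoint s t) W (ind U) (ind V') = Qf := by
    unfold Q S; rfl
  rw [hQ]
  rcases hZ0.lt_or_eq with hpos | hzero
  · have : Z * 0 ≤ Z * Qf := by nlinarith
    exact le_of_mul_le_mul_left this hpos
  · -- all coefficients vanish
    have hall : ∀ s t : Finset V, coef (fun s t : Finset V => Disjoint s t) W s t = 0 := by
      intro s t
      have h := (Finset.sum_eq_zero_iff_of_nonneg (fun s _ => Finset.sum_nonneg fun t _ =>
        coef_nonneg (fun s t : Finset V => Disjoint s t) hW0 s t)).mp hzero.symm s (Finset.mem_univ s)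
      exact (Finset.sum_eq_zero_iff_of_nonneg (fun t _ => coef_nonneg (fun s t : Finset V => Disjoint s t) hW0 s t)).mp h t
        (Finset.mem_univ t)
    simp only [hQf, hall, zero_mul, Finset.sum_const_zero, le_refl]

end LSM

end Summit.Ventures.PercRepro2.WForm
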